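import Mathlib.Tactic
import HarnessLib
import HarnessLib.Audit.Tags
import Summits.CriticalPhenomena.PercolationContinuityZ3.Theorems.PercNearOneGluingNoHeavyLowerTailSahiRainbowMaxTwo
import Summits.CriticalPhenomena.PercolationContinuityZ3.Theorems.PercNearOneGluingNoHeavyLowerTailSahiRainbowMaxDichotomy

/-!
# The max-antichain accounting: complement duality (the MIN-antichain accounting for free)

Support file (seat `prim-masterthm-p1`, gen 39; `--supports stmt-CriticalPhenomena-4575`).  Unconditional theorems, no new definitions, no
`sorry`, standard axioms.  Memo `run/shared/lean/prim/prim-masterthm/FROM-prim-masterthm-p1-g39-MAX-ACCOUNTING.md` §2.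

SETTING: `rainbowMeets F P = {∅} ∪ meets ∪ complemented joins`; the rainbow lemma `#P ≤ #rainbowMeets F P` for complement-free `P ⊆ 2^F`;
the max-antichain criteria of `…SahiRainbowMax{,Dichotomy,Two}` (generic position, no small cover, at most two hard members).

NEW HERE ([this work], gen 39).  Complementation inside `F` maps `P` to the complement-free family `P.image (F \ ·)` of the same size and with
the SAME rainbow meets (`rainbowMeets_image_compl`: meets of complements are complemented joins and vice versa).  Hence every criterion for the
rainbow lemma may be applied to the complemented family instead (`card_le_card_rainbowMeets_of_image_compl`) — i.e. the accounting may be run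
on the MINIMAL members of `P`:
* `card_le_card_rainbowMeets_of_card_hardMembers_compl_le_two`: at most two hard members of the complemented family ⟹ RAINBOW(P);
* `card_le_card_rainbowMeets_of_no_small_cover_compl`, `card_le_card_rainbowMeets_of_generic_compl`: the no-small-cover and generic-position
  criteria applied to the complemented family (no three maximal members of `P.image (F \ ·)` cover `F`, i.e. no three minimal members of `P`
  have empty common part) ⟹ RAINBOW(P).
(Uses `sdiff_injOn_subsets`, `card_image_compl`, `subset_of_mem_image_compl` of `…SahiAntichainDual`.)
HONEST FRAMING: unconditional corollaries; the general case remains OPEN. [this work]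
-/

namespace Summit.CriticalPhenomena.PercolationContinuityZ3.Theorems.SahiColouredDaykin

open Finset

variable {α : Type*} [DecidableEq α]

section Dual

variable {F : Finset α} {P : Finset (Finset α)}

/-- The complemented family of a complement-free family is complement-free. [this work] -/
theorem image_compl_complFree (hPF : ∀ S ∈ P, S ⊆ F) (hcf : ∀ S ∈ P, F \ S ∉ P) :
    ∀ S ∈ P.image (F \ ·), F \ S ∉ P.image (F \ ·) := by
  intro S hS hS'
  obtain ⟨a, ha, rfl⟩ := mem_image.1 hS
  obtain ⟨b, hb, hba⟩ := mem_image.1 hS'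
  -- `F \ b = F \ (F \ a) = a`, so `a = F \ b` with `b ∈ P`
  rw [Finset.sdiff_sdiff_eq_self (hPF a ha)] at hba
  exact hcf b hb (hba ▸ ha)

/-- **Complementation preserves the rainbow meets**: the meets of complements are the complemented joins, and the complemented joins of
complements are the meets. [this work] -/
theorem rainbowMeets_image_compl (hPF : ∀ S ∈ P, S ⊆ F) : rainbowMeets F (P.image (F \ ·)) = rainbowMeets F P := by
  ext Z
  rw [mem_rainbowMeets_iff, mem_rainbowMeets_iff]
  constructor
  · rintro (rfl | ⟨a', ha', b', hb', hab', hZ⟩)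
    · exact Or.inl rfl
    · obtain ⟨a, ha, rfl⟩ := mem_image.1 ha'
      obtain ⟨b, hb, rfl⟩ := mem_image.1 hb'
      have hab : a ≠ b := fun h => hab' (by rw [h])
      refine Or.inr ⟨a, ha, b, hb, hab, ?_⟩
      rcases hZ with rfl | rfl
      · right; rw [Finset.sdiff_union_distrib]
      · left
        rw [← Finset.sdiff_inter_distrib_right, Finset.sdiff_sdiff_eq_self (inter_subset_left.trans (hPF a ha))]
  · rintro (rfl | ⟨a, ha, b, hb, hab, hZ⟩)
    · exact Or.inl rfl
    · have ha' : F \ a ∈ P.image (F \ ·) := mem_image.2 ⟨a, ha, rfl⟩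
      have hb' : F \ b ∈ P.image (F \ ·) := mem_image.2 ⟨b, hb, rfl⟩
      have hab' : F \ a ≠ F \ b := fun h => hab (sdiff_injOn_subsets F hPF (mem_coe.2 ha) (mem_coe.2 hb) h)
      refine Or.inr ⟨F \ a, ha', F \ b, hb', hab', ?_⟩
      rcases hZ with rfl | rfl
      · right
        rw [← Finset.sdiff_inter_distrib_right, Finset.sdiff_sdiff_eq_self (inter_subset_left.trans (hPF a ha))]
      · left; rw [Finset.sdiff_union_distrib]

/-- **The rainbow lemma transfers from the complemented family.** [this work] -/
theorem card_le_card_rainbowMeets_of_image_compl (hPF : ∀ S ∈ P, S ⊆ F)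
    (h : #(P.image (F \ ·)) ≤ #(rainbowMeets F (P.image (F \ ·)))) : #P ≤ #(rainbowMeets F P) := by
  rwa [card_image_compl hPF, rainbowMeets_image_compl hPF] at h

/-- **At most two hard members in the complemented family ⟹ RAINBOW** (the min-antichain version of
`card_le_card_rainbowMeets_of_card_hardMembers_le_two`). [this work] -/
theorem card_le_card_rainbowMeets_of_card_hardMembers_compl_le_two (hPF : ∀ S ∈ P, S ⊆ F) (hcf : ∀ S ∈ P, F \ S ∉ P)
    (h2 : #(hardMembers F (P.image (F \ ·))) ≤ 2) : #P ≤ #(rainbowMeets F P) :=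
  card_le_card_rainbowMeets_of_image_compl hPF
    (card_le_card_rainbowMeets_of_card_hardMembers_le_two subset_of_mem_image_compl (image_compl_complFree hPF hcf) h2)

/-- **No small cover among the maximal members of the complemented family ⟹ RAINBOW** (equivalently: no one, two or three minimal members of `P`
have empty common part inside `F`; stated on the complemented family). [this work] -/
theorem card_le_card_rainbowMeets_of_no_small_cover_compl (hPF : ∀ S ∈ P, S ⊆ F) (hcf : ∀ S ∈ P, F \ S ∉ P)
    (h3 : ∀ a ∈ maxMembers (P.image (F \ ·)), ∀ b ∈ maxMembers (P.image (F \ ·)), ∀ c ∈ maxMembers (P.image (F \ ·)), a ∪ b ∪ c ≠ F) :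
    #P ≤ #(rainbowMeets F P) :=
  card_le_card_rainbowMeets_of_image_compl hPF
    (card_le_card_rainbowMeets_of_no_small_cover subset_of_mem_image_compl (image_compl_complFree hPF hcf) h3)

/-- **Generic position of the complemented family ⟹ RAINBOW.** [this work] -/
theorem card_le_card_rainbowMeets_of_generic_compl (hPF : ∀ S ∈ P, S ⊆ F) (hcf : ∀ S ∈ P, F \ S ∉ P)
    (hG1 : ∀ a ∈ maxMembers (P.image (F \ ·)), F \ a ∉ rainbowMeets F (maxMembers (P.image (F \ ·))))
    (hG2 : ∀ a ∈ maxMembers (P.image (F \ ·)), ∀ b ∈ maxMembers (P.image (F \ ·)), ∀ c ∈ maxMembers (P.image (F \ ·)),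
      b ≠ c → ¬ F \ (b ∪ c) ⊂ a) :
    #P ≤ #(rainbowMeets F P) :=
  card_le_card_rainbowMeets_of_image_compl hPF
    (card_le_card_rainbowMeets_of_generic subset_of_mem_image_compl (image_compl_complFree hPF hcf) hG1 hG2)

end Dual

end Summit.CriticalPhenomena.PercolationContinuityZ3.Theorems.SahiColouredDaykin
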